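import Summits.Ventures.HodgeRepro2.T5SU11AbelTransform

/-!
# The Abel transform of `cosh^{-k}` is `C_k cosh^{1−k}`, the Fourier–Laplace transform of `cosh^{-ν}`,
and a third derivation of the Jacobi transform of `m_k`

The horocycle integral of `T5SU11BetaExp` gives the Abel transform of the lowest-weight coefficient
modulus in closed form: **`A m_k(t) = e^{t} ∫_ℝ m_k(a_t n_s) ds = C_k cosh^{1−k} t`** with
`C_k = √π Γ((k−1)/2)/Γ(k/2)` (`abel_orbit_rpow`, `k > 1`) — the Abel transform lowers the exponent of
`cosh` by one. The Fourier–Laplace transform of `cosh^{-ν}` is a Beta integral,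
**`∫_ℝ e^{μ t} cosh^{-ν} t dt = 2^{ν−1} Γ((ν+μ)/2) Γ((ν−μ)/2)/Γ(ν)`** for `|μ| < ν`
(`integral_exp_mul_cosh_rpow_neg`, from the exponential Beta integral of `T5SU11BetaExp`). Through the
Abel factorisation of `T5SU11AbelTransform` these give a THIRD evaluation of the spherical transform of
`m_k`, `∫_G m_k φ_λ dν = ∫_ℝ e^{(λ−1) t} C_k cosh^{1−k} t dt`, agreeing with the closed form of
`T5SU11JacobiTransform` (`integral_orbit_rpow_mul_sph_abel`, `jacobi_abel_cross_check`). Nothing is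
claimed about (N).

Blind lane: Mathlib + the HodgeRepro2 prefix only; no sorry; axioms ⊆ {propext, Classical.choice,
Quot.sound}.
-/

namespace Summit.Ventures.HodgeRepro2.T5SU11AbelCosh

open MeasureTheory MeasureTheory.Measure Metric Set Filter Topology Complex
open T5SU11Unimodular T5SU11Fibration T5SU11Cartan T5SU11OneParameter T5SU11CartanProjection
  T5HaarCircle T5BergmanCoefficient T5SU11FibrationHaar T5SU11UnipotentSubgroup
  T5SU11IwasawaProjection T5SU11SphericalFunction T5SU11BetaImproper T5SU11BetaExp
  T5SU11JacobiIwasawa T5SU11JacobiTransform T5SU11AbelTransform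
open scoped Real

/-! ### The Fourier–Laplace transform of `cosh^{-ν}` -/

/-- `cosh^{-ν} t = 2^ν e^{-ν t} (1 + e^{-2t})^{-ν}`. -/
lemma cosh_rpow_neg_eq (ν t : ℝ) :
    Real.cosh t ^ (-ν) = 2 ^ ν * (Real.exp (-ν * t) * (1 + Real.exp (-2 * t)) ^ (-ν)) := by
  have h1 : Real.cosh t = (Real.exp t * (1 + Real.exp (-2 * t))) / 2 := by
    rw [Real.cosh_eq]
    have e : Real.exp t * Real.exp (-2 * t) = Real.exp (-t) := by
      rw [← Real.exp_add]; congr 1; ring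
    linear_combination (-1 / 2 : ℝ) * e
  have h2 : (0 : ℝ) < Real.exp t * (1 + Real.exp (-2 * t)) := by positivity
  rw [h1, Real.div_rpow h2.le (by norm_num), Real.mul_rpow (Real.exp_pos _).le (by positivity),
    ← Real.exp_mul, Real.rpow_neg (by norm_num : (0 : ℝ) ≤ 2), div_eq_mul_inv, inv_inv]
  ring_nf

/-- **The Fourier–Laplace transform of `cosh^{-ν}`**:
`∫_ℝ e^{μ t} cosh^{-ν} t dt = 2^{ν−1} Γ((ν+μ)/2) Γ((ν−μ)/2)/Γ(ν)` for `|μ| < ν`. -/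
theorem integral_exp_mul_cosh_rpow_neg {ν μ : ℝ} (h1 : μ < ν) (h2 : -ν < μ) :
    ∫ t : ℝ, Real.exp (μ * t) * Real.cosh t ^ (-ν)
      = 2 ^ (ν - 1) * (Real.Gamma ((ν + μ) / 2) * Real.Gamma ((ν - μ) / 2) / Real.Gamma ν) := by
  have ha : 0 < (ν - μ) / 2 := by linarith
  have hb : 0 < (ν + μ) / 2 := by linarith
  have hpt : ∀ t : ℝ, Real.exp (μ * t) * Real.cosh t ^ (-ν)
      = 2 ^ ν * (Real.exp (-(2 * ((ν - μ) / 2)) * t)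
          * (1 + Real.exp (-2 * t)) ^ (-((ν - μ) / 2 + (ν + μ) / 2))) := by
    intro t
    rw [cosh_rpow_neg_eq, show (ν - μ) / 2 + (ν + μ) / 2 = ν by ring,
      show -(2 * ((ν - μ) / 2)) * t = μ * t + -ν * t by ring, Real.exp_add]
    ring
  simp_rw [hpt]
  rw [MeasureTheory.integral_const_mul, integral_exp_mul_one_add_exp_rpow_neg ha hb,
    show (ν - μ) / 2 + (ν + μ) / 2 = ν by ring,
    show (2 : ℝ) ^ ν = 2 ^ (ν - 1) * 2 by
      rw [show ν = (ν - 1) + 1 by ring, Real.rpow_add (by norm_num), Real.rpow_one]; ring_nf]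
  have hΓ : 0 < Real.Gamma ν := Real.Gamma_pos_of_pos (by linarith)
  field_simp

/-- `e^{μt} cosh^{-ν}` is integrable on `ℝ` for `|μ| < ν` (a posteriori). -/
theorem integrable_exp_mul_cosh_rpow_neg {ν μ : ℝ} (h1 : μ < ν) (h2 : -ν < μ) :
    Integrable (fun t : ℝ => Real.exp (μ * t) * Real.cosh t ^ (-ν)) := by
  by_contra h
  have h0 := integral_undef h
  rw [integral_exp_mul_cosh_rpow_neg h1 h2] at h0
  have g1 : 0 < Real.Gamma ((ν + μ) / 2) := Real.Gamma_pos_of_pos (by linarith)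
  have g2 : 0 < Real.Gamma ((ν - μ) / 2) := Real.Gamma_pos_of_pos (by linarith)
  have g3 : 0 < Real.Gamma ν := Real.Gamma_pos_of_pos (by linarith)
  have g4 : (0 : ℝ) < 2 ^ (ν - 1) := Real.rpow_pos_of_pos (by norm_num) _
  have : 0 < 2 ^ (ν - 1) * (Real.Gamma ((ν + μ) / 2) * Real.Gamma ((ν - μ) / 2) / Real.Gamma ν) := by
    positivity
  linarith

/-! ### The Abel transform of `cosh^{-k}` -/

/-- **The Abel transform of the coefficient modulus**: `e^{t} ∫_ℝ m_k(a_t n_s) ds = C_k cosh^{1−k} t`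
with `C_k = √π Γ((k−1)/2)/Γ(k/2)`, for `k > 1` — the Abel transform lowers the exponent by one. -/
theorem abel_orbit_rpow {k : ℝ} (hk : 1 < k) (t : ℝ) :
    Real.exp t * ∫ s : ℝ, (Real.cosh t ^ 2 + s ^ 2 * Real.exp (2 * t)) ^ (-(k / 2))
      = (√π * Real.Gamma ((k - 1) / 2) / Real.Gamma (k / 2)) * Real.cosh t ^ (1 - k) := by
  rw [integral_cosh_sq_add_sq_mul_exp_rpow hk t, show (1 - k) = -(k - 1) by ring,
    cosh_rpow_neg_eq (k - 1) t, show -(k - 1) * t = -k * t + t by ring, Real.exp_add]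
  ring

/-- **The Abel transform of `m_k` on the group**: `e^{t} ∫_ℝ m_k(a_t n_s) ds = C_k cosh^{1−k} t`. -/
theorem abel_orbit_rpow' {k : ℝ} (hk : 1 < k) (t : ℝ) :
    Real.exp t * ∫ s : ℝ, (1 - ‖orbit (hyp t * unip s)‖ ^ 2) ^ (k / 2)
      = (√π * Real.Gamma ((k - 1) / 2) / Real.Gamma (k / 2)) * Real.cosh t ^ (1 - k) := by
  simp_rw [one_sub_norm_orbit_sq_rpow_hyp_mul_unip]
  exact abel_orbit_rpow hk t

/-- The same identity read off directly from the Fourier–Laplace transform of `cosh^{1−k}`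
(no group integral involved): the two analytic evaluations coincide. -/
theorem jacobi_abel_cross_check' {k lam : ℝ} (h1 : lam < k) (h2 : 2 < k + lam) :
    ∫ t : ℝ, Real.exp ((lam - 1) * t) * Real.cosh t ^ (-(k - 1))
      = 2 ^ (k - 2) * (Real.Gamma ((k - lam) / 2) * Real.Gamma ((k + lam) / 2 - 1) / Real.Gamma (k - 1)) := by
  rw [integral_exp_mul_cosh_rpow_neg (by linarith) (by linarith),
    show k - 1 - 1 = k - 2 by ring, show (k - 1 + (lam - 1)) / 2 = (k + lam) / 2 - 1 by ring,
    show (k - 1 - (lam - 1)) / 2 = (k - lam) / 2 by ring, mul_comm (Real.Gamma ((k + lam) / 2 - 1))]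

/-! ### The third derivation of the Jacobi transform -/

section measure

variable [MeasurableSpace Circle] [BorelSpace Circle]

/-- **The Jacobi transform of `m_k` through the Abel transform**:
`∫_G m_k φ_λ dν = C_k ∫_ℝ e^{(λ−1) t} cosh^{1−k} t dt` for `k > 1`, `λ < k`, `k + λ > 2`. -/
theorem integral_orbit_rpow_mul_sph_abel {k lam : ℝ} (hk : 1 < k) (h1 : lam < k)
    (h2 : 2 < k + lam) :
    ∫ g, (1 - ‖orbit g‖ ^ 2) ^ (k / 2) * sph lam g ∂(nu haarCircle)
      = (√π * Real.Gamma ((k - 1) / 2) / Real.Gamma (k / 2))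
          * ∫ t : ℝ, Real.exp ((lam - 1) * t) * Real.cosh t ^ (-(k - 1)) := by
  rw [integral_orbit_rpow_mul_sph_eq_abel hk h1 h2, ← MeasureTheory.integral_const_mul]
  congr 1
  funext t
  have h := abel_orbit_rpow hk t
  rw [show 1 - k = -(k - 1) by ring] at h
  have e : Real.exp (lam * t) = Real.exp ((lam - 1) * t) * Real.exp t := by
    rw [← Real.exp_add]; congr 1; ring
  rw [e, mul_assoc, h]
  ring

/-- **THE THIRD DERIVATION AGREES**: the Abel route reproduces the closed form of
`T5SU11JacobiTransform` — a Gamma identity between the two evaluations, `k > 1`, `λ < k`, `k + λ > 2`. -/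
theorem jacobi_abel_cross_check {k lam : ℝ} (hk : 1 < k) (h1 : lam < k) (h2 : 2 < k + lam) :
    (√π * Real.Gamma ((k - 1) / 2) / Real.Gamma (k / 2))
        * ∫ t : ℝ, Real.exp ((lam - 1) * t) * Real.cosh t ^ (-(k - 1))
      = 2 ^ (k - 2) * (√π * Real.Gamma ((k - 1) / 2) / Real.Gamma (k / 2))
          * (Real.Gamma ((k - lam) / 2) * Real.Gamma ((k + lam) / 2 - 1) / Real.Gamma (k - 1)) := by
  rw [← integral_orbit_rpow_mul_sph_abel hk h1 h2, integral_orbit_rpow_mul_sph hk h1 h2]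

end measure

end Summit.Ventures.HodgeRepro2.T5SU11AbelCosh
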